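import Mathlib
import Summits.CriticalPhenomena.CardyFormulaZ2.Theses.CardyTensorRG

/-!
# Rate transfer through a locally Lipschitz / `C¹` observable
(helper for the support item RGToPolyominoLaw, stmt-CriticalPhenomena-14645, route CardyTensorRG)

The glue item RGToPolyominoLaw (card T4) passes from GEOMETRIC convergence of the blocked bulk
tensors `R.map^[k] (ιW c) → γ (pOf c)` (clause (d) of `GaussianSaddleCertificate`) and of the
boundary/corner tensors (BoundaryTwistTensors, informal) to GEOMETRIC convergence of the crossing
probabilities of the lattice rectangles `[0, m·2^k] × [0, n·2^k]` (`DyadicContraction`): for fixed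
`(m, n)` the crossing probability is ONE finite open-network contraction — a `C¹` function `Φ m n`
of the finitely many tensors — evaluated along the level-`k` tensor datum. This file proves the
analytic part of that passage, with the two untyped inputs (the Baxter–Kelland–Wu representation
identity and the tensor datum with its rate) as explicit hypotheses in Mathlib vocabulary:

* `geometric_rate_of_lipschitzOnWith` — a map Lipschitz on a neighbourhood of the limit sends a
  sequence converging at geometric rate `θ ∈ [0,1)` to one converging at the same rate (all `k`,
  one constant);
* `geometric_rate_of_contDiffAt` — the same for a `C¹` map between real normed spaces;
* `dyadicShape_of_eventually_geometric` — an EVENTUALLY geometric bound `|P k - L| ≤ C θ^k`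
  upgrades to the `∀ k` shape `∃ C' θ', 0 ≤ θ' ∧ θ' < 1 ∧ ∀ k, |P k - L| ≤ C' θ'^k` of
  `DyadicContraction`;
* `dyadicContraction_of_representation` — `DyadicContraction` follows from: one geometrically
  convergent datum `x k → a` in a real normed space, `C¹` functionals `Φ m n` at `a`, and the
  representation `crossingProb half (m·2^k) (n·2^k) = Φ m n (x k)` for all large `k`.
-/

namespace Summit.CriticalPhenomena.CardyFormulaZ2.Theorems

open Filter Topology

/-- **Rate transfer, Lipschitz form.** If `dist (x k) a ≤ C θ^k` with `0 ≤ θ < 1` and `Φ` is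
Lipschitz on some neighbourhood `s` of `a`, then `dist (Φ (x k)) (Φ a) ≤ C' θ^k` for all `k`, for
one constant `C'` (the finitely many indices with `x k ∉ s` have `θ^k > 0` and are absorbed). -/
theorem geometric_rate_of_lipschitzOnWith {E F : Type*} [PseudoMetricSpace E]
    [PseudoMetricSpace F] {Φ : E → F} {x : ℕ → E} {a : E} {s : Set E} (hs : s ∈ 𝓝 a)
    {K : NNReal} (hΦ : LipschitzOnWith K Φ s) {C θ : ℝ} (hθ0 : 0 ≤ θ) (hθ1 : θ < 1)
    (hx : ∀ k, dist (x k) a ≤ C * θ ^ k) :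
    ∃ C' : ℝ, ∀ k, dist (Φ (x k)) (Φ a) ≤ C' * θ ^ k := by
  have ha : a ∈ s := mem_of_mem_nhds hs
  have hC : 0 ≤ C := by simpa using dist_nonneg.trans (hx 0)
  obtain ⟨ε, hε, hball⟩ := Metric.mem_nhds_iff.1 hs
  have hlim : Tendsto (fun k => C * θ ^ k) atTop (𝓝 0) := by
    simpa using (tendsto_pow_atTop_nhds_zero_of_lt_one hθ0 hθ1).const_mul C
  obtain ⟨k₀, hk₀⟩ := eventually_atTop.1 (hlim.eventually (gt_mem_nhds hε))
  have hKC : 0 ≤ (K : ℝ) * C := mul_nonneg K.coe_nonneg hC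
  have hgood : ∀ k, x k ∈ s → dist (Φ (x k)) (Φ a) ≤ K * C * θ ^ k := by
    intro k hk
    calc dist (Φ (x k)) (Φ a) ≤ K * dist (x k) a := hΦ.dist_le_mul (x k) hk a ha
      _ ≤ K * (C * θ ^ k) := by gcongr; exact hx k
      _ = K * C * θ ^ k := by ring
  set S : ℝ := ∑ j ∈ Finset.range k₀, dist (Φ (x j)) (Φ a) / θ ^ j with hSdef
  have hS : 0 ≤ S := Finset.sum_nonneg fun j _ => div_nonneg dist_nonneg (pow_nonneg hθ0 j)
  refine ⟨K * C + S, fun k => ?_⟩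
  have hθk : 0 ≤ θ ^ k := pow_nonneg hθ0 k
  by_cases hk : x k ∈ s
  · calc dist (Φ (x k)) (Φ a) ≤ K * C * θ ^ k := hgood k hk
      _ ≤ (K * C + S) * θ ^ k := by gcongr; linarith
  · -- a bad index: then `ε ≤ C θ^k`, so `k < k₀` and `θ^k > 0`
    have hεle : ε ≤ C * θ ^ k := by
      by_contra h
      exact hk (hball (Metric.mem_ball.2 ((hx k).trans_lt (not_le.1 h))))
    have hk_lt : k < k₀ := by
      by_contra h
      exact absurd (hk₀ k (not_lt.1 h)) (not_lt.2 hεle)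
    have hθpos : 0 < θ ^ k := by
      rcases hθk.eq_or_lt with h | h
      · rw [← h, mul_zero] at hεle
        exact absurd hεle (not_le.2 hε)
      · exact h
    have hle : dist (Φ (x k)) (Φ a) / θ ^ k ≤ S :=
      Finset.single_le_sum (f := fun j => dist (Φ (x j)) (Φ a) / θ ^ j)
        (fun j _ => div_nonneg dist_nonneg (pow_nonneg hθ0 j)) (Finset.mem_range.2 hk_lt)
    calc dist (Φ (x k)) (Φ a) = dist (Φ (x k)) (Φ a) / θ ^ k * θ ^ k := by
          field_simp
      _ ≤ S * θ ^ k := by gcongr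
      _ ≤ (K * C + S) * θ ^ k := by gcongr; linarith

/-- **Rate transfer, `C¹` form.** A `C¹` map between real normed spaces is Lipschitz near each point
(`ContDiffAt.exists_lipschitzOnWith`), so it preserves geometric rates of convergence. -/
theorem geometric_rate_of_contDiffAt {E F : Type*} [NormedAddCommGroup E] [NormedSpace ℝ E]
    [NormedAddCommGroup F] [NormedSpace ℝ F] {Φ : E → F} {x : ℕ → E} {a : E}
    (hΦ : ContDiffAt ℝ 1 Φ a) {C θ : ℝ} (hθ0 : 0 ≤ θ) (hθ1 : θ < 1)
    (hx : ∀ k, ‖x k - a‖ ≤ C * θ ^ k) :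
    ∃ C' : ℝ, ∀ k, ‖Φ (x k) - Φ a‖ ≤ C' * θ ^ k := by
  obtain ⟨K, t, ht, hK⟩ := hΦ.exists_lipschitzOnWith
  have hx' : ∀ k, dist (x k) a ≤ C * θ ^ k := fun k => by rw [dist_eq_norm]; exact hx k
  obtain ⟨C', hC'⟩ := geometric_rate_of_lipschitzOnWith ht hK hθ0 hθ1 hx'
  exact ⟨C', fun k => by rw [← dist_eq_norm]; exact hC' k⟩

/-- **From an eventual geometric bound to the `DyadicContraction` shape.** If `|P k - L| ≤ C θ^k`
for all large `k` with `0 ≤ θ < 1`, then `|P k - L| ≤ C' θ'^k` for ALL `k` with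
`θ' = max θ (1/2) ∈ (0, 1)` and one constant `C'` (early terms absorbed since `θ' > 0`). -/
theorem dyadicShape_of_eventually_geometric {P : ℕ → ℝ} {L C θ : ℝ} (hθ0 : 0 ≤ θ)
    (hθ1 : θ < 1) (h : ∀ᶠ k in atTop, |P k - L| ≤ C * θ ^ k) :
    ∃ C' θ' : ℝ, 0 ≤ θ' ∧ θ' < 1 ∧ ∀ k, |P k - L| ≤ C' * θ' ^ k := by
  set θ' : ℝ := max θ (1 / 2) with hθ'def
  have hθ'pos : 0 < θ' := lt_max_of_lt_right one_half_pos
  have hθ'1 : θ' < 1 := max_lt hθ1 one_half_lt_one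
  have hθθ' : θ ≤ θ' := le_max_left _ _
  obtain ⟨k₀, hk₀⟩ := eventually_atTop.1 h
  set S : ℝ := ∑ j ∈ Finset.range k₀, |P j - L| / θ' ^ j with hSdef
  have hS : 0 ≤ S :=
    Finset.sum_nonneg fun j _ => div_nonneg (abs_nonneg _) (pow_nonneg hθ'pos.le j)
  refine ⟨max C 0 + S, θ', hθ'pos.le, hθ'1, fun k => ?_⟩
  have hθ'k : 0 < θ' ^ k := pow_pos hθ'pos k
  by_cases hk : k₀ ≤ k
  · calc |P k - L| ≤ C * θ ^ k := hk₀ k hk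
      _ ≤ max C 0 * θ ^ k := mul_le_mul_of_nonneg_right (le_max_left _ _) (pow_nonneg hθ0 k)
      _ ≤ max C 0 * θ' ^ k :=
          mul_le_mul_of_nonneg_left (pow_le_pow_left₀ hθ0 hθθ' k) (le_max_right _ _)
      _ ≤ (max C 0 + S) * θ' ^ k := by gcongr; linarith
  · have hk_lt : k < k₀ := not_le.1 hk
    have hle : |P k - L| / θ' ^ k ≤ S :=
      Finset.single_le_sum (f := fun j => |P j - L| / θ' ^ j)
        (fun j _ => div_nonneg (abs_nonneg _) (pow_nonneg hθ'pos.le j)) (Finset.mem_range.2 hk_lt)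
    calc |P k - L| = |P k - L| / θ' ^ k * θ' ^ k := by field_simp
      _ ≤ S * θ' ^ k := by gcongr
      _ ≤ (max C 0 + S) * θ' ^ k := by gcongr; linarith [le_max_right C 0]

/-- **`DyadicContraction` from a `C¹` representation with geometric tensor convergence.** The
RG half of T4 for lattice rectangles, with its two tensor-side inputs as hypotheses: ONE datum
`x k → a` converging geometrically in a real normed space `E` (bulk ⊕ boundary ⊕ corner tensors at
blocking level `k`, from GaussianSaddleCertificate (d) and BoundaryTwistTensors), functionals
`Φ m n` that are `C¹` at `a` (finite open-network contractions), and the representation identity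
`crossingProb half (m·2^k) (n·2^k) = Φ m n (x k)` for all large `k` (Baxter–Kelland–Wu dictionary
B1 + exact covariance of open networks under blocking). Conclusion: `DyadicContraction`, with
limit `L = Φ m n a`. -/
theorem dyadicContraction_of_representation {E : Type*} [NormedAddCommGroup E] [NormedSpace ℝ E]
    (x : ℕ → E) (a : E) {C θ : ℝ} (hθ0 : 0 ≤ θ) (hθ1 : θ < 1)
    (hx : ∀ k, ‖x k - a‖ ≤ C * θ ^ k) (Φ : ℕ → ℕ → E → ℝ)
    (hΦ : ∀ m n : ℕ, 1 ≤ m → 1 ≤ n → ContDiffAt ℝ 1 (Φ m n) a)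
    (hrep : ∀ m n : ℕ, 1 ≤ m → 1 ≤ n → ∀ᶠ k in atTop,
      Literature.Probability.Percolation.crossingProb Literature.Probability.Percolation.half
        (m * 2 ^ k) (n * 2 ^ k) = Φ m n (x k)) :
    Summit.CriticalPhenomena.CardyFormulaZ2.Theses.CardyTensorRG.DyadicContraction := by
  intro m n hm hn
  obtain ⟨C₁, hC₁⟩ := geometric_rate_of_contDiffAt (hΦ m n hm hn) hθ0 hθ1 hx
  have h : ∀ᶠ k in atTop,
      |Literature.Probability.Percolation.crossingProb Literature.Probability.Percolation.half
          (m * 2 ^ k) (n * 2 ^ k) - Φ m n a| ≤ C₁ * θ ^ k := by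
    filter_upwards [hrep m n hm hn] with k hk
    rw [hk, ← Real.norm_eq_abs]
    exact hC₁ k
  obtain ⟨C', θ', h0, h1, hall⟩ := dyadicShape_of_eventually_geometric hθ0 hθ1 h
  exact ⟨Φ m n a, C', θ', h0, h1, hall⟩

end Summit.CriticalPhenomena.CardyFormulaZ2.Theorems
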